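import Literature.Probability.Percolation.ArmSeparationSlotArith
import Literature.Probability.Percolation.ArmSeparationSpoke
import HarnessLib

/-!
# The thin spokes of the adjacent landing meet their ring pieces

Topic `Literature/Probability/Percolation`; family `crit-perc` / near-critical percolation on `𝕋`.
A brick of the near-critical arm-separation theorem for four arms in the ADJACENT colour
arrangement (P. Nolin, EJP 13 (2008), Thm. 11, `j = 4`, `σ = BBWW` [arXiv 0711.4948: Thm. 10]),
landing step. The spokes of the two corridor systems of a fenced exit are the thin horizontal tubes
`adjSpoke aS c L ε = [aS, aS + L] × [c - ε, c + ε]` of the frame of the exit's side (start column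
`aS = 2M + 1` or `2M + k`, centre row `c`). As the tree's `ospokeMeets_pieceTube` for the beacon
spokes: if the centre row lies in the lateral chunk `ι` of the ring of radius `r = n s`
(`-r + ι s ≤ c < -r + (ι+1) s`), `ε ≤ e`, the spoke reaches across the ring's band
(`r + e + ε ≤ aS + L`) and the ring lies a chunk beyond the start (`aS + s + e + ε ≤ r`), then
`SpokeMeets i (adjSpoke aS c L ε) (pieceTube r e s n i ι)` for every frame `i < 6`
(`adjSpokeMeets_pieceTube`). Everything here is proved.

## References

* P. Nolin, Near-critical percolation in two dimensions, *Electron. J. Probab.* 13 (2008), §4.3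
  Prop. 12 (proof) (arXiv 0711.4948: Prop. 11) [Nolin2008].
-/

noncomputable section

open Set

namespace Literature.Probability.Percolation

open LatticeModels Tube

/-- **A thin spoke**: the horizontal tube `[aS, aS + L] × [c - ε, c + ε]`. [cite: Nolin2008, §4.3 Prop. 12 (proof) (arXiv 0711.4948: Prop. 11)] -/
def adjSpoke (aS c : ℤ) (L ε : ℕ) : Tube := ⟨aS, c - ε, L, 2 * ε, true⟩

/-- The thin spoke is horizontal. [folklore] -/
@[simp] theorem adjSpoke_horiz (aS c : ℤ) (L ε : ℕ) : (adjSpoke aS c L ε).horiz = true := rfl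

/-- Aspect ratio of a thin spoke: `L ≤ ρ (2ε)`, `1 ≤ ε`. [folklore] -/
theorem aspectLE_adjSpoke (aS c : ℤ) {L ε ρ : ℕ} (hε : 1 ≤ ε) (hL : L ≤ ρ * (2 * ε)) : (adjSpoke aS c L ε).AspectLE ρ := by
  unfold AspectLE adjSpoke; simp only [cond_true]; exact ⟨hL, by omega⟩

section Meets

variable {aS c : ℤ} {L ε r e s n ι : ℕ}

/-- Frame `0`: the thin spoke meets `V_ι`. [folklore] -/
theorem adjSpokeMeets_zero (hι : -(r : ℤ) + ι * s ≤ c ∧ c < -(r : ℤ) + (ι + 1) * s) (hεe : ε ≤ e)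
    (ha : (r : ℤ) + e + ε ≤ aS + L) (hb : aS + s + e + ε ≤ r) :
    SpokeMeets 0 (adjSpoke aS c L ε) (vPiece r (-(r : ℤ)) e s ι) := by
  have hεe' : (ε : ℤ) ≤ e := by exact_mod_cast hεe
  refine ⟨rfl, ?_, ?_, ?_, ?_⟩ <;>
    simp only [adjSpoke, vPiece, Nat.cast_add, Nat.cast_mul, Nat.cast_ofNat] <;>
    linarith [hι.1, hι.2]

/-- Frame `1`: the thin spoke meets the step `H_ι`. [folklore] -/
theorem adjSpokeMeets_one (hι : -(r : ℤ) + ι * s ≤ c ∧ c < -(r : ℤ) + (ι + 1) * s) (hεe : ε ≤ e)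
    (ha : (r : ℤ) + e + ε ≤ aS + L) (hb : aS + s + e + ε ≤ r) :
    SpokeMeets 1 (adjSpoke aS c L ε) (stairH r e s ι) := by
  have hεe' : (ε : ℤ) ≤ e := by exact_mod_cast hεe
  refine ⟨rfl, ?_, ?_, ?_, ?_⟩ <;>
    simp only [adjSpoke, stairH, Nat.cast_add, Nat.cast_mul, Nat.cast_ofNat] <;>
    linarith [hι.1, hι.2]

/-- Frame `2`: the thin spoke meets the piece `H_{n-1-ι}` of the side `x₁ = r` (`n s = r`, `ι < n`). [folklore] -/
theorem adjSpokeMeets_two (hns : n * s = r) (hιn : ι < n)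
    (hι : -(r : ℤ) + ι * s ≤ c ∧ c < -(r : ℤ) + (ι + 1) * s) (hεe : ε ≤ e)
    (ha : (r : ℤ) + e + ε ≤ aS + L) (hb : aS + s + e + ε ≤ r) :
    SpokeMeets 2 (adjSpoke aS c L ε) (hPiece 0 r e s (n - 1 - ι)) := by
  have hεe' : (ε : ℤ) ≤ e := by exact_mod_cast hεe
  have hns' : (n : ℤ) * s = r := by exact_mod_cast hns
  have hcast : ((n - 1 - ι : ℕ) : ℤ) = n - 1 - ι := by omega
  refine ⟨rfl, ?_, ?_, ?_, ?_⟩ <;>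
    simp only [adjSpoke, hPiece, hcast, Nat.cast_add, Nat.cast_mul, Nat.cast_ofNat] <;>
    linarith [hι.1, hι.2]

/-- Frame `3`: the thin spoke meets `-V_ι`. [folklore] -/
theorem adjSpokeMeets_three (hι : -(r : ℤ) + ι * s ≤ c ∧ c < -(r : ℤ) + (ι + 1) * s) (hεe : ε ≤ e)
    (ha : (r : ℤ) + e + ε ≤ aS + L) (hb : aS + s + e + ε ≤ r) :
    SpokeMeets 3 (adjSpoke aS c L ε) (vPiece r (-(r : ℤ)) e s ι).neg := by
  have hεe' : (ε : ℤ) ≤ e := by exact_mod_cast hεe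
  refine ⟨rfl, ?_, ?_, ?_, ?_⟩ <;>
    simp only [adjSpoke, vPiece, neg_a, neg_b, neg_w, neg_h, Nat.cast_add, Nat.cast_mul, Nat.cast_ofNat] <;>
    linarith [hι.1, hι.2]

/-- Frame `4`: the thin spoke meets `-H_ι`. [folklore] -/
theorem adjSpokeMeets_four (hι : -(r : ℤ) + ι * s ≤ c ∧ c < -(r : ℤ) + (ι + 1) * s) (hεe : ε ≤ e)
    (ha : (r : ℤ) + e + ε ≤ aS + L) (hb : aS + s + e + ε ≤ r) :
    SpokeMeets 4 (adjSpoke aS c L ε) (stairH r e s ι).neg := by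
  have hεe' : (ε : ℤ) ≤ e := by exact_mod_cast hεe
  refine ⟨rfl, ?_, ?_, ?_, ?_⟩ <;>
    simp only [adjSpoke, stairH, neg_a, neg_b, neg_w, neg_h, Nat.cast_add, Nat.cast_mul, Nat.cast_ofNat] <;>
    linarith [hι.1, hι.2]

/-- Frame `5`: the thin spoke meets `-H_{n-1-ι}` (`n s = r`, `ι < n`). [folklore] -/
theorem adjSpokeMeets_five (hns : n * s = r) (hιn : ι < n)
    (hι : -(r : ℤ) + ι * s ≤ c ∧ c < -(r : ℤ) + (ι + 1) * s) (hεe : ε ≤ e)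
    (ha : (r : ℤ) + e + ε ≤ aS + L) (hb : aS + s + e + ε ≤ r) :
    SpokeMeets 5 (adjSpoke aS c L ε) (hPiece 0 r e s (n - 1 - ι)).neg := by
  have hεe' : (ε : ℤ) ≤ e := by exact_mod_cast hεe
  have hns' : (n : ℤ) * s = r := by exact_mod_cast hns
  have hcast : ((n - 1 - ι : ℕ) : ℤ) = n - 1 - ι := by omega
  refine ⟨rfl, ?_, ?_, ?_, ?_⟩ <;>
    simp only [adjSpoke, hPiece, hcast, neg_a, neg_b, neg_w, neg_h, Nat.cast_add, Nat.cast_mul, Nat.cast_ofNat] <;>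
    linarith [hι.1, hι.2]

/-- **The thin spoke of the frame `i` meets the piece of its side with the lateral index of its
centre row.** [cite: Nolin2008, §4.3 Prop. 12 (proof) (arXiv 0711.4948: Prop. 11)] -/
theorem adjSpokeMeets_pieceTube {i : ℕ} (hi : i < 6) (hns : n * s = r) (hιn : ι < n)
    (hι : -(r : ℤ) + ι * s ≤ c ∧ c < -(r : ℤ) + (ι + 1) * s) (hεe : ε ≤ e)
    (ha : (r : ℤ) + e + ε ≤ aS + L) (hb : aS + s + e + ε ≤ r) :
    SpokeMeets i (adjSpoke aS c L ε) (pieceTube r e s n i ι) := by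
  interval_cases i
  · exact adjSpokeMeets_zero hι hεe ha hb
  · exact adjSpokeMeets_one hι hεe ha hb
  · exact adjSpokeMeets_two hns hιn hι hεe ha hb
  · exact adjSpokeMeets_three hι hεe ha hb
  · exact adjSpokeMeets_four hι hεe ha hb
  · exact adjSpokeMeets_five hns hιn hι hεe ha hb

end Meets

end Literature.Probability.Percolation
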